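import Mathlib
import HarnessLib
import Summits.HubbardSuperconductivity.HubbardSuperconductivity.Theorems.WeakCouplingBCSDefsKlCertB1gT
import Summits.HubbardSuperconductivity.HubbardSuperconductivity.Theorems.WeakCouplingBCSWcbcsKohnLuttingerB1gKlCertForm
import Summits.HubbardSuperconductivity.HubbardSuperconductivity.Theorems.WeakCouplingBCSWcbcsKohnLuttingerB1gKlCertFormD
import Summits.HubbardSuperconductivity.HubbardSuperconductivity.Theorems.WeakCouplingBCSDefsKlCertB1gWinU1Record

/-!
# Route `WeakCouplingBCS` — support item `WcbcsKohnLuttingerB1g` (stmt-HubbardSuperconductivity-0158):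
# the NEGATIVE leaf of the `t' = 0` Kohn–Luttinger certificate and the right EDGE of the `d_{x²-y²}` window

What a FAILED margin certifies (cell gate-hubbard-kl, KL-MARGIN-SCAN reader hubbard-klscan-idea-3, crux idea
`failed-margin-dwave-edge`, graded new-combination / keep by hubbard-klscan-crit-1).  On the frozen `t' = 0` record vocabulary
(`KLCert`, `KLBox`, `KLBlock.{ritzOK, lowerOKd, lower, rhohi, RitzEnclosure, Enclosure}`, unchanged) this file adds

* `KlNotB1g.notB1gCheck c χ` — a one-competitor NEGATIVE leaf checker: on every box of the record the rival channel `χ`'s Ritz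
  CEILING lies strictly below the `B1g` certified FLOOR (far-channel bound + ONE admissible PSD deflation term), so `d_{x²-y²}` is
  NOT the Kohn–Luttinger channel on the box; `KlNotB1g.NotB1gLeaf` / `notB1gLeaf_holds` — its soundness, a composition of the
  tree's row lemmas `klb1g_ritz_upper`, `klb1gd_blockLower`, `klhs_channelInf_sq` under the named enclosure hypothesis
  `EnclosuresNotB1g c χ` (exactly what an interval engine certifies, as for the positive leaves);
* `KlNotB1g.rivalMargin`, `rivalMargin_continuousOn` (from `klb1g_continuousOn_channelInf`), `marginZero_exists`,
  `rivalMargin_lastZero` — intermediate-value bracketing of an exact degeneracy of the leading mean-zero channels between a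
  negative cell and a positive cell, and the LAST such zero;
* `KlNotB1g.DWaveEdge` / `dWaveEdge_holds` (PROVED): a negative cell to the left (in `μ`) of a positive cell certifies the right
  edge `μe` of the `d_{x²-y²}` window inside the bracket with strict `B1g` selection on `(μe, b]`;
* `KlNotB1g.DWaveEdgeT0` / `dWaveEdgeT0_of_records`: a negative record accepted by `notB1gCheck` (with its enclosures) + the LANDED
  positive window record `klCertB1gWinU1` (with its enclosures) ⇒ `DWaveEdgeT0`.

No new record TYPE, no `instance`, no `notation`; the negative RECORD itself (rationals certified by the cell's interval engine) is
not in this file — `dWaveEdgeT0_of_records` takes it as an argument.  Folklore glue (interval arithmetic bookkeeping + IVT).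
A Kohn–Luttinger `O(U²)` channel statement is not ODLRO and proves nothing about superconductivity in the Hubbard model.
-/

noncomputable section

set_option linter.dupNamespace false

namespace Summit.HubbardSuperconductivity.HubbardSuperconductivity.Theorems

open Literature.MathematicalPhysics.QuantumLattice
open Summit.HubbardSuperconductivity.HubbardSuperconductivity.Theorems.CwKLChiralWindow

namespace KlNotB1g

/-- The unconventional rivals of `B1g`: the three other mean-zero channels `A2g, B2g, E` (their bottoms are exactly
`U²`-homogeneous, `klhs_channelInf_sq`; `A1g` carries the bare-`U` penalty and is not a weak-coupling rival). [folklore] -/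
def IsRival (χ : D4Irrep) : Prop := χ ≠ D4Irrep.B1g ∧ χ ≠ D4Irrep.A1g

/-- Boolean form of `IsRival` read by the checker (explicit `def`, no instance declared). -/
def isRivalB (χ : D4Irrep) : Bool := decide (χ ≠ D4Irrep.B1g) && decide (χ ≠ D4Irrep.A1g)

/-- The Boolean test `isRivalB` decides `IsRival`. [folklore] -/
theorem isRival_of_isRivalB {χ : D4Irrep} (h : isRivalB χ = true) : IsRival χ := by
  unfold isRivalB at h
  simp only [Bool.and_eq_true, decide_eq_true_eq] at h
  exact h

/-- **Box test of the negative leaf**: the box is well formed (`-4 < mulo ≤ muhi < 0`), the rival block `χ` carries usable Ritz data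
(`ritzOK`), the `B1g` block a certified lower row (`lowerOKd`: Temple or far-channel data, `dmult B1g = 1`), and the rival's Ritz
ceiling lies strictly below the `B1g` floor: `rhohi(χ) < lower(B1g)`. Kernel-decidable. -/
def notB1gBoxOK (bx : KLBox) (tab : List KLTrig) (χ : D4Irrep) : Bool :=
  decide (-4 < bx.mulo) && decide (bx.mulo ≤ bx.muhi) && decide (bx.muhi < 0) &&
    (bx.blk χ).ritzOK tab χ && bx.bB1g.lowerOKd tab .B1g &&
    decide ((bx.blk χ).rhohi < bx.bB1g.lower tab .B1g)

/-- **The negative-leaf checker** (same window/box bookkeeping as `KLCert.checkB1gD`; a point record `mub = mua` is allowed):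
`χ ∉ {B1g, A1g}`, window ends `-4 < mub ≤ mua < 0`, boxes non-empty, contiguous (`chainOK`) and covering `[mub, mua]`, and
`notB1gBoxOK χ` on every box.  The fields `gamma`, `cov`, the node data and the three unused blocks are not read. -/
def notB1gCheck (c : KLCert) (χ : D4Irrep) : Bool :=
  isRivalB χ &&
  decide (-4 < c.mub) && decide (c.mub ≤ c.mua) && decide (c.mua < 0) &&
    (match c.boxes.head?, c.boxes.getLast? with
      | some b₀, some b₁ => decide (b₀.mulo ≤ c.mub) && decide (c.mua ≤ b₁.muhi)
      | _, _ => false) &&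
    KLCert.chainOK c.boxes &&
    (c.boxes.all fun bx => notB1gBoxOK bx c.trials χ)

/-- **The named numerical hypothesis of a negative cell** (certified interval arithmetic, minimal form): on every box, uniformly in
`μ`, the Ritz rows E1–E2 of the rival block and the block enclosure E1–E4 of the `B1g` block (of which only the deflated square mass
`Hhi`, row E4, is read when `B1g` carries no trial).  Implied by `KLCert.EnclosuresB1gT` when the rival block's trial is in use. [folklore] -/
def EnclosuresNotB1g (c : KLCert) (χ : D4Irrep) : Prop :=
  ∀ bx ∈ c.boxes, ∀ μ ∈ Set.Icc (bx.mulo : ℝ) (bx.muhi : ℝ),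
    (bx.blk χ).RitzEnclosure c.trials μ ∧ bx.bB1g.Enclosure c.trials μ D4Irrep.B1g

/-- **FIRST LEMMA — soundness of the negative leaf.**  A record accepted by `notB1gCheck χ`, with its enclosures, certifies that the
rival `χ` lies STRICTLY below `B1g` on the whole window, at every coupling `0 < U ≤ 1`:
`channelInf ε₀ μ U χ ≤ U²·rhohi(χ) < U²·lower(B1g) ≤ channelInf ε₀ μ U B1g`
(`klb1g_ritz_upper` for the rival — `ritzOK` with `χ ≠ A1g` forces `withU = false`; `klb1gd_blockLower` for `B1g`; `U²`-homogeneity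
`klhs_channelInf_sq` of both mean-zero channels; the cover logic of `klb1gd_coverLogic`).  No new analysis. (the card's own statement — no cite tag) -/
def NotB1gLeaf : Prop :=
  ∀ (c : KLCert) (χ : D4Irrep), notB1gCheck c χ = true → EnclosuresNotB1g c χ →
    ∀ μ ∈ Set.Icc ((c.mub : ℚ) : ℝ) ((c.mua : ℚ) : ℝ), ∀ U ∈ Set.Ioc (0 : ℝ) 1,
      channelInf (squareDispersion 1 0) μ U χ < channelInf (squareDispersion 1 0) μ U D4Irrep.B1g

/-- **Cover logic of `notB1gCheck`** (verbatim the bookkeeping of `klb1gd_coverLogic`, chain cover `kl_cvl_chain_cover`). -/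
theorem notB1gCheck_coverLogic (c : KLCert) (χ : D4Irrep) (hc : notB1gCheck c χ = true) :
    IsRival χ ∧ (-4 < c.mub ∧ c.mub ≤ c.mua ∧ c.mua < 0) ∧
    (∀ bx ∈ c.boxes, notB1gBoxOK bx c.trials χ = true) ∧
    (∀ μ : ℝ, ((c.mub : ℚ) : ℝ) ≤ μ → μ ≤ ((c.mua : ℚ) : ℝ) →
      ∃ bx ∈ c.boxes, ((bx.mulo : ℚ) : ℝ) ≤ μ ∧ μ ≤ ((bx.muhi : ℚ) : ℝ)) := by
  unfold notB1gCheck at hc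
  simp only [Bool.and_eq_true, decide_eq_true_eq] at hc
  obtain ⟨⟨⟨⟨⟨⟨hr, h₁⟩, h₂⟩, h₃⟩, hmatch⟩, hchain⟩, hall⟩ := hc
  refine ⟨isRival_of_isRivalB hr, ⟨h₁, h₂, h₃⟩, fun bx hbx => List.all_eq_true.1 hall bx hbx, ?_⟩
  intro μ hμ₁ hμ₂
  split at hmatch
  · rename_i b₀ b₁ hb₀ hb₁
    simp only [Bool.and_eq_true, decide_eq_true_eq] at hmatch
    obtain ⟨L, hL⟩ := List.head?_eq_some_iff.1 hb₀
    rw [hL] at hchain hb₁ ⊢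
    have hlo : ((b₀.mulo : ℚ) : ℝ) ≤ μ := le_trans (by exact_mod_cast hmatch.1) hμ₁
    have hhi : μ ≤ ((b₁.muhi : ℚ) : ℝ) := le_trans hμ₂ (by exact_mod_cast hmatch.2)
    exact kl_cvl_chain_cover L b₀ b₁ hchain hb₁ μ hlo hhi
  · exact absurd hmatch Bool.false_ne_true

/-- **Box certificate of the negative leaf** (`U = 1`): Ritz ceiling of the rival (`klb1g_ritz_upper`; `IsRival` gives the equality
case `χ ≠ A1g`) `<` certified floor of `B1g` (`klb1gd_blockLower`). -/
theorem notB1gBox_certificate {μ : ℝ} (bx : KLBox) (tab : List KLTrig) (χ : D4Irrep) (hχ : IsRival χ)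
    (hB : notB1gBoxOK bx tab χ = true) (hμ : μ ∈ Set.Icc ((bx.mulo : ℚ) : ℝ) ((bx.muhi : ℚ) : ℝ))
    (hER : (bx.blk χ).RitzEnclosure tab μ) (hEB : bx.bB1g.Enclosure tab μ D4Irrep.B1g) :
    channelInf (squareDispersion 1 0) μ 1 χ < channelInf (squareDispersion 1 0) μ 1 D4Irrep.B1g := by
  unfold notB1gBoxOK at hB
  simp only [Bool.and_eq_true, decide_eq_true_eq] at hB
  obtain ⟨⟨⟨⟨⟨h4, -⟩, h0⟩, hR⟩, hL⟩, hlt⟩ := hB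
  have hμo : μ ∈ Set.Ioo (-4 : ℝ) 0 :=
    ⟨lt_of_lt_of_le (by exact_mod_cast h4) hμ.1, lt_of_le_of_lt hμ.2 (by exact_mod_cast h0)⟩
  have hup := klb1g_ritz_upper hμo (bx.blk χ) tab χ hR (Or.inr hχ.2) hER
  have hlow := klb1gd_blockLower hμo bx.bB1g tab D4Irrep.B1g hEB hL
  have hlt' : (((bx.blk χ).rhohi : ℚ) : ℝ) < ((bx.bB1g.lower tab .B1g : ℚ) : ℝ) := by exact_mod_cast hlt
  linarith

/-- **The negative leaf is sound** (proof of `NotB1gLeaf`: cover logic, box certificate, and the exact `U²`-homogeneity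
`klhs_channelInf_sq` of the two mean-zero channels, `stub_klMeanZero`). -/
theorem notB1gLeaf_holds : NotB1gLeaf := by
  intro c χ hc hE μ hμ U hU
  obtain ⟨hχ, ⟨h4, -, h0⟩, hboxes, hcover⟩ := notB1gCheck_coverLogic c χ hc
  obtain ⟨bx, hbx, hlo, hhi⟩ := hcover μ hμ.1 hμ.2
  obtain ⟨hER, hEB⟩ := hE bx hbx μ ⟨hlo, hhi⟩
  have h1 := notB1gBox_certificate bx c.trials χ hχ (hboxes bx hbx) ⟨hlo, hhi⟩ hER hEB
  have hμo : μ ∈ Set.Ioo (-4 : ℝ) 0 :=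
    ⟨lt_of_lt_of_le (by exact_mod_cast h4) hμ.1, lt_of_le_of_lt hμ.2 (by exact_mod_cast h0)⟩
  have hK := stub_klKernelHS
  have hfin : MeasureTheory.IsFiniteMeasure (fermiCurveMeasure (squareDispersion 1 0) μ) :=
    stub_klFiniteMeasure stub_klGradient stub_klHausdorffFinite μ hμo
  have hinv := stub_klD4Invariant stub_klGradient μ hμo
  have hhomχ : channelInf (squareDispersion 1 0) μ U χ = U ^ 2 * channelInf (squareDispersion 1 0) μ 1 χ :=
    klhs_channelInf_sq hK hμo U χ (fun ψ hψ => (stub_klMeanZero _ _ hfin hinv χ ψ hχ.2 hψ).2)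
  have hhomB : channelInf (squareDispersion 1 0) μ U D4Irrep.B1g =
      U ^ 2 * channelInf (squareDispersion 1 0) μ 1 D4Irrep.B1g :=
    klhs_channelInf_sq hK hμo U D4Irrep.B1g (fun ψ hψ => (stub_klMeanZero _ _ hfin hinv D4Irrep.B1g ψ (by decide) hψ).2)
  rw [hhomχ, hhomB]
  have hU2 : 0 < U ^ 2 := by have := hU.1; positivity
  exact mul_lt_mul_of_pos_left h1 hU2

/-- `KLCert.EnclosuresB1gT` (all five blocks, rows E1–E4) implies the minimal hypothesis when the rival's trial is in use
(which `notB1gCheck` enforces through `ritzOK`). -/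
theorem enclosuresNotB1g_of_enclosuresB1gT (c : KLCert) (χ : D4Irrep)
    (huse : ∀ bx ∈ c.boxes, (bx.blk χ).useTrial = true) (hE : c.EnclosuresB1gT) : EnclosuresNotB1g c χ := by
  intro bx hbx μ hμ
  have hχ := hE bx hbx μ hμ χ
  have hB := hE bx hbx μ hμ D4Irrep.B1g
  obtain ⟨h1, h2, h3, h4, -⟩ := hχ.1 (huse bx hbx)
  exact ⟨⟨h1, h2, h3, h4⟩, hB⟩

/-- **Zero margin at `μ`** (normalisation `U = 1`; by homogeneity the same at every `U > 0`): `B1g` is still weakly lowest among the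
mean-zero channels and some rival attains the same bottom — an exact (accidental) degeneracy of the leading Kohn–Luttinger channels. [folklore] -/
def MarginZero (μ : ℝ) : Prop :=
  (∀ χ : D4Irrep, IsRival χ → channelInf (squareDispersion 1 0) μ 1 D4Irrep.B1g ≤ channelInf (squareDispersion 1 0) μ 1 χ) ∧
    ∃ χ : D4Irrep, IsRival χ ∧ channelInf (squareDispersion 1 0) μ 1 χ = channelInf (squareDispersion 1 0) μ 1 D4Irrep.B1g

/-- The rival margin function `m(μ) = min (λ_A2g, λ_B2g, λ_E)(μ) - λ_B1g(μ)` at `U = 1`. -/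
def rivalMargin (μ : ℝ) : ℝ :=
  min (min (channelInf (squareDispersion 1 0) μ 1 D4Irrep.A2g) (channelInf (squareDispersion 1 0) μ 1 D4Irrep.B2g))
      (channelInf (squareDispersion 1 0) μ 1 D4Irrep.E) - channelInf (squareDispersion 1 0) μ 1 D4Irrep.B1g

/-- The rival margin `m(μ)` is continuous on `(-4, 0)` (each `channelInf` is, `klb1g_continuousOn_channelInf`). [folklore] -/
theorem rivalMargin_continuousOn : ContinuousOn rivalMargin (Set.Ioo (-4 : ℝ) 0) := by
  have hA : ContinuousOn (fun μ => channelInf (squareDispersion 1 0) μ 1 D4Irrep.A2g) (Set.Ioo (-4 : ℝ) 0) :=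
    klb1g_continuousOn_channelInf 1 D4Irrep.A2g
  have hB : ContinuousOn (fun μ => channelInf (squareDispersion 1 0) μ 1 D4Irrep.B2g) (Set.Ioo (-4 : ℝ) 0) :=
    klb1g_continuousOn_channelInf 1 D4Irrep.B2g
  have hE : ContinuousOn (fun μ => channelInf (squareDispersion 1 0) μ 1 D4Irrep.E) (Set.Ioo (-4 : ℝ) 0) :=
    klb1g_continuousOn_channelInf 1 D4Irrep.E
  have hD : ContinuousOn (fun μ => channelInf (squareDispersion 1 0) μ 1 D4Irrep.B1g) (Set.Ioo (-4 : ℝ) 0) :=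
    klb1g_continuousOn_channelInf 1 D4Irrep.B1g
  exact ContinuousOn.sub (ContinuousOn.inf (ContinuousOn.inf hA hB) hE) hD

/-- The rivals of `B1g` are exactly `A2g`, `B2g`, `E`. [folklore] -/
theorem isRival_iff (χ : D4Irrep) : IsRival χ ↔ χ = D4Irrep.A2g ∨ χ = D4Irrep.B2g ∨ χ = D4Irrep.E := by
  cases χ <;> simp [IsRival]

/-- `m(μ) ≤ λ_χ(μ) - λ_B1g(μ)` for every rival `χ`. -/
theorem rivalMargin_le (μ : ℝ) {χ : D4Irrep} (hχ : IsRival χ) :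
    rivalMargin μ ≤ channelInf (squareDispersion 1 0) μ 1 χ - channelInf (squareDispersion 1 0) μ 1 D4Irrep.B1g := by
  rcases (isRival_iff χ).1 hχ with rfl | rfl | rfl <;> unfold rivalMargin <;> gcongr
  · exact (min_le_left _ _).trans (min_le_left _ _)
  · exact (min_le_left _ _).trans (min_le_right _ _)
  · exact min_le_right _ _

/-- `m(μ) = 0 ↔` zero margin at `μ`. -/
theorem marginZero_of_rivalMargin_eq_zero {μ : ℝ} (h : rivalMargin μ = 0) : MarginZero μ := by
  refine ⟨fun χ hχ => by linarith [rivalMargin_le μ hχ], ?_⟩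
  -- the minimum of the three rivals is attained
  have hmin : ∃ χ : D4Irrep, IsRival χ ∧
      min (min (channelInf (squareDispersion 1 0) μ 1 D4Irrep.A2g) (channelInf (squareDispersion 1 0) μ 1 D4Irrep.B2g))
        (channelInf (squareDispersion 1 0) μ 1 D4Irrep.E) = channelInf (squareDispersion 1 0) μ 1 χ := by
    rcases min_choice (min (channelInf (squareDispersion 1 0) μ 1 D4Irrep.A2g) (channelInf (squareDispersion 1 0) μ 1 D4Irrep.B2g))
        (channelInf (squareDispersion 1 0) μ 1 D4Irrep.E) with h1 | h1
    · rcases min_choice (channelInf (squareDispersion 1 0) μ 1 D4Irrep.A2g) (channelInf (squareDispersion 1 0) μ 1 D4Irrep.B2g)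
          with h2 | h2
      · exact ⟨D4Irrep.A2g, ⟨by decide, by decide⟩, h1.trans h2⟩
      · exact ⟨D4Irrep.B2g, ⟨by decide, by decide⟩, h1.trans h2⟩
    · exact ⟨D4Irrep.E, ⟨by decide, by decide⟩, h1⟩
  obtain ⟨χ, hχ, hχeq⟩ := hmin
  refine ⟨χ, hχ, ?_⟩
  unfold rivalMargin at h
  linarith

/-- **THE DUAL STEP (proved): a failed margin to the left of a certified margin brackets an exact channel degeneracy.**
If at `a` some rival lies strictly below `B1g` (a negative cell) and at `b` the `B1g` channel strictly leads every rival (a positive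
cell), `-4 < a ≤ b < 0`, then the margin vanishes somewhere in `(a, b)`: intermediate value theorem for the continuous rival margin
(`klb1g_continuousOn_channelInf`). -/
theorem marginZero_exists {a b : ℝ} (ha : -4 < a) (hab : a ≤ b) (hb : b < 0)
    (hneg : ∃ χ : D4Irrep, IsRival χ ∧ channelInf (squareDispersion 1 0) a 1 χ < channelInf (squareDispersion 1 0) a 1 D4Irrep.B1g)
    (hpos : ∀ χ : D4Irrep, IsRival χ → channelInf (squareDispersion 1 0) b 1 D4Irrep.B1g < channelInf (squareDispersion 1 0) b 1 χ) :
    ∃ μ ∈ Set.Ioo a b, MarginZero μ := by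
  have hcont : ContinuousOn rivalMargin (Set.Icc a b) :=
    rivalMargin_continuousOn.mono fun x hx => ⟨lt_of_lt_of_le ha hx.1, lt_of_le_of_lt hx.2 hb⟩
  have hma : rivalMargin a < 0 := by
    obtain ⟨χ, hχ, hlt⟩ := hneg
    linarith [rivalMargin_le a hχ]
  have hmb : 0 < rivalMargin b := by
    have hA := hpos D4Irrep.A2g ⟨by decide, by decide⟩
    have hB := hpos D4Irrep.B2g ⟨by decide, by decide⟩
    have hE := hpos D4Irrep.E ⟨by decide, by decide⟩
    unfold rivalMargin
    rcases min_choice (min (channelInf (squareDispersion 1 0) b 1 D4Irrep.A2g) (channelInf (squareDispersion 1 0) b 1 D4Irrep.B2g))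
        (channelInf (squareDispersion 1 0) b 1 D4Irrep.E) with h1 | h1 <;> rw [h1]
    · rcases min_choice (channelInf (squareDispersion 1 0) b 1 D4Irrep.A2g) (channelInf (squareDispersion 1 0) b 1 D4Irrep.B2g)
          with h2 | h2 <;> rw [h2] <;> linarith
    · linarith
  obtain ⟨μ, hμ, hμ0⟩ := intermediate_value_Icc hab hcont ⟨hma.le, hmb.le⟩
  have hμa : μ ≠ a := by rintro rfl; exact (hma.ne hμ0)
  have hμb : μ ≠ b := by rintro rfl; exact (hmb.ne' hμ0)
  exact ⟨μ, ⟨lt_of_le_of_ne hμ.1 hμa.symm, lt_of_le_of_ne hμ.2 hμb⟩, marginZero_of_rivalMargin_eq_zero hμ0⟩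

/-- **The last zero below a positive point**: if the rival margin is negative at `a` and positive at `b` (`-4 < a ≤ b < 0`), its LAST
zero `μe` on `[a, b]` has zero margin and strictly positive margin on `(μe, b]` (supremum of the closed zero-or-below set, plus
`marginZero_exists` on `[μe, b]` to exclude a negative value at the supremum). -/
theorem rivalMargin_lastZero {a b : ℝ} (ha : -4 < a) (hab : a ≤ b) (hb : b < 0)
    (hneg : rivalMargin a < 0) (hpos : 0 < rivalMargin b) :
    ∃ μe ∈ Set.Ioo a b, rivalMargin μe = 0 ∧ ∀ x ∈ Set.Ioc μe b, 0 < rivalMargin x := by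
  have hcont : ContinuousOn rivalMargin (Set.Icc a b) :=
    rivalMargin_continuousOn.mono fun x hx => ⟨lt_of_lt_of_le ha hx.1, lt_of_le_of_lt hx.2 hb⟩
  set S : Set ℝ := Set.Icc a b ∩ rivalMargin ⁻¹' Set.Iic 0 with hS
  have hSclosed : IsClosed S := hcont.preimage_isClosed_of_isClosed isClosed_Icc isClosed_Iic
  have haS : a ∈ S := ⟨⟨le_rfl, hab⟩, hneg.le⟩
  have hSne : S.Nonempty := ⟨a, haS⟩
  have hSbdd : BddAbove S := ⟨b, fun x hx => hx.1.2⟩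
  set μe := sSup S with hμe
  have hμeS : μe ∈ S := hSclosed.csSup_mem hSne hSbdd
  have hμe_le0 : rivalMargin μe ≤ 0 := hμeS.2
  have hμe_ab : μe ∈ Set.Icc a b := hμeS.1
  -- strictly positive margin to the right of `μe` (up to `b`)
  have hright : ∀ x ∈ Set.Ioc μe b, 0 < rivalMargin x := by
    intro x hx
    by_contra hxle
    have hxS : x ∈ S := ⟨⟨hμe_ab.1.trans hx.1.le, hx.2⟩, not_lt.1 hxle⟩
    exact absurd (le_csSup hSbdd hxS) (not_le.2 hx.1)
  -- the margin at `μe` is not negative: otherwise the IVT gives a zero strictly to the right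
  have hμe_ge0 : 0 ≤ rivalMargin μe := by
    by_contra hlt'
    have hlt : rivalMargin μe < 0 := not_le.1 hlt'
    have hcont' : ContinuousOn rivalMargin (Set.Icc μe b) :=
      hcont.mono (Set.Icc_subset_Icc hμe_ab.1 le_rfl)
    obtain ⟨z, hz, hz0⟩ := intermediate_value_Icc hμe_ab.2 hcont' ⟨hlt.le, hpos.le⟩
    have hzne : z ≠ μe := by rintro rfl; exact hlt.ne hz0
    have hzpos := hright z ⟨lt_of_le_of_ne hz.1 hzne.symm, hz.2⟩
    linarith
  have hzero : rivalMargin μe = 0 := le_antisymm hμe_le0 hμe_ge0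
  have hμe_ne_a : μe ≠ a := by rintro h; rw [h] at hzero; exact hneg.ne hzero
  have hμe_ne_b : μe ≠ b := by rintro h; rw [h] at hzero; exact hpos.ne' hzero
  exact ⟨μe, ⟨lt_of_le_of_ne hμe_ab.1 hμe_ne_a.symm, lt_of_le_of_ne hμe_ab.2 hμe_ne_b⟩, hzero, hright⟩

/-- **The edge bracket a consumer reads** (second lemma of the line): a positive window record (`checkB1gD`, `EnclosuresB1g` — e.g. the
LANDED `klCertB1gWinU1`, `μ ∈ [-357/400, -69/80]`, `δ ≈ 0.35`) and a negative cell to its left (`notB1gCheck χ`, `EnclosuresNotB1g`)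
certify the RIGHT EDGE `μe` of the `d_{x²-y²}` Kohn–Luttinger window: zero margin at `μe`, `B1g` strictly selected among the mean-zero
channels on `(μe, mua₊]` (the last zero of the rival margin below the positive window; `marginZero_exists` gives a zero, closedness of
the zero set the last one). (the card's own statement — no cite tag) -/
def DWaveEdge : Prop :=
  ∀ (cpos cneg : KLCert) (χ : D4Irrep), cpos.checkB1gD = true → cpos.EnclosuresB1g →
    notB1gCheck cneg χ = true → EnclosuresNotB1g cneg χ → cneg.mua ≤ cpos.mub →
    ∃ μe ∈ Set.Ioo ((cneg.mua : ℚ) : ℝ) ((cpos.mub : ℚ) : ℝ), MarginZero μe ∧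
      ∀ μ ∈ Set.Ioc μe ((cpos.mua : ℚ) : ℝ), ∀ χ' : D4Irrep, IsRival χ' →
        channelInf (squareDispersion 1 0) μ 1 D4Irrep.B1g < channelInf (squareDispersion 1 0) μ 1 χ'

/-- **The edge bracket is a theorem** (proof of `DWaveEdge`): the negative leaf (`notB1gLeaf_holds`) gives a negative rival margin at
`cneg.mua`, the positive record (`klb1gd_window`, `gamma > 0`) a positive one on `[cpos.mub, cpos.mua]`; `rivalMargin_lastZero` on
`[cneg.mua, cpos.mub]` and `marginZero_of_rivalMargin_eq_zero` finish. -/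
theorem dWaveEdge_holds : DWaveEdge := by
  intro cpos cneg χ hcpos hEpos hcneg hEneg hle
  obtain ⟨hχ, ⟨h4n, hban, h0n⟩, -, -⟩ := notB1gCheck_coverLogic cneg χ hcneg
  obtain ⟨⟨h4p, hbap, h0p, hγ⟩, -, -⟩ := klb1gd_coverLogic cpos hcpos
  have hwin := klb1gd_window cpos hcpos hEpos
  -- negative margin at `a = cneg.mua`
  have ha_mem : (((cneg.mua : ℚ) : ℝ)) ∈ Set.Icc ((cneg.mub : ℚ) : ℝ) ((cneg.mua : ℚ) : ℝ) :=
    ⟨by exact_mod_cast hban, le_rfl⟩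
  have hnegχ := notB1gLeaf_holds cneg χ hcneg hEneg _ ha_mem 1 ⟨one_pos, le_rfl⟩
  have hneg : rivalMargin ((cneg.mua : ℚ) : ℝ) < 0 := by linarith [rivalMargin_le (((cneg.mua : ℚ) : ℝ)) hχ]
  -- positive margin on the positive window, in particular at `b = cpos.mub`
  have hposw : ∀ μ ∈ Set.Icc ((cpos.mub : ℚ) : ℝ) ((cpos.mua : ℚ) : ℝ), ∀ χ' : D4Irrep, IsRival χ' →
      channelInf (squareDispersion 1 0) μ 1 D4Irrep.B1g < channelInf (squareDispersion 1 0) μ 1 χ' := by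
    intro μ hμ χ' hχ'
    have h := hwin μ hμ χ' hχ'.1
    have hγ' : (0 : ℝ) < ((cpos.gamma : ℚ) : ℝ) := by exact_mod_cast hγ
    linarith
  have hb_mem : (((cpos.mub : ℚ) : ℝ)) ∈ Set.Icc ((cpos.mub : ℚ) : ℝ) ((cpos.mua : ℚ) : ℝ) :=
    ⟨le_rfl, by exact_mod_cast hbap.le⟩
  have hpos : 0 < rivalMargin ((cpos.mub : ℚ) : ℝ) := by
    have hA := hposw _ hb_mem D4Irrep.A2g ⟨by decide, by decide⟩
    have hB := hposw _ hb_mem D4Irrep.B2g ⟨by decide, by decide⟩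
    have hE := hposw _ hb_mem D4Irrep.E ⟨by decide, by decide⟩
    unfold rivalMargin
    rcases min_choice (min (channelInf (squareDispersion 1 0) ((cpos.mub : ℚ) : ℝ) 1 D4Irrep.A2g)
        (channelInf (squareDispersion 1 0) ((cpos.mub : ℚ) : ℝ) 1 D4Irrep.B2g))
        (channelInf (squareDispersion 1 0) ((cpos.mub : ℚ) : ℝ) 1 D4Irrep.E) with h1 | h1 <;> rw [h1]
    · rcases min_choice (channelInf (squareDispersion 1 0) ((cpos.mub : ℚ) : ℝ) 1 D4Irrep.A2g)
          (channelInf (squareDispersion 1 0) ((cpos.mub : ℚ) : ℝ) 1 D4Irrep.B2g) with h2 | h2 <;> rw [h2] <;> linarith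
    · linarith
  obtain ⟨μe, hμe, hzero, hright⟩ :=
    rivalMargin_lastZero (a := ((cneg.mua : ℚ) : ℝ)) (b := ((cpos.mub : ℚ) : ℝ))
      (by have h := lt_of_lt_of_le h4n hban; exact_mod_cast h) (by exact_mod_cast hle)
      (by have h := hbap.trans h0p; exact_mod_cast h) hneg hpos
  refine ⟨μe, hμe, marginZero_of_rivalMargin_eq_zero hzero, ?_⟩
  intro μ hμ χ' hχ'
  rcases le_or_gt μ ((cpos.mub : ℚ) : ℝ) with hμb | hμb
  · have hm := hright μ ⟨hμ.1, hμb⟩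
    linarith [rivalMargin_le μ hχ']
  · exact hposw μ ⟨hμb.le, hμ.2⟩ χ' hχ'

/-- **The located negative cell** (float-located, to be certified by the EXISTING `t' = 0` engine; `t = 1, t' = 0`): on
`μ ∈ [-71/50, -67/50]` (doping `δ ≈ 0.475–0.495`) the `d_xy` channel `B2g` lies strictly below `B1g` at every `0 < U ≤ 1` — beyond the
right edge, `d_{x²-y²}` is NOT the Kohn–Luttinger channel.  FLOAT profile at `μ = -1.40`: `λ_B1g = -0.0022` (its top mode `≈ cos 2θ` is
REPELLED, `+0.021`), one-term-deflated far floor `-0.0041`; `B2g` one-harmonic (`sin 2θ`) Ritz `-0.0158`, `λ_B2g = -0.0187 ≈ λ_E`. (the card's own statement — no cite tag) -/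
def NotDWaveCellMu140 : Prop :=
  ∀ μ ∈ Set.Icc (-71 / 50 : ℝ) (-67 / 50), ∀ U ∈ Set.Ioc (0 : ℝ) 1,
    channelInf (squareDispersion 1 0) μ U D4Irrep.B2g < channelInf (squareDispersion 1 0) μ U D4Irrep.B1g

/-- **The `t' = 0` edge datum (HQ1 (i)/(iii))**: the right edge of the `d_{x²-y²}` window lies at some `μe ∈ (-67/50, -357/400)`
(float `μe ≈ -1.104`, `δe ≈ 0.41`, partner `E` with `B2g` 1 % behind): zero margin at `μe` and strict `B1g` selection among the
mean-zero channels on `(μe, -69/80]` (and on to `μ = -0.075`, `δ = 0.05`, by the landed window `klb1g_window_d005_d035`).  Follows from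
`DWaveEdge`, a certified `NotDWaveCellMu140`-type record and `klCertB1gWinU1` (hypothesis `klCertB1gWinU1.EnclosuresB1g`). (the card's own statement — no cite tag) -/
def DWaveEdgeT0 : Prop :=
  ∃ μe : ℝ, -67 / 50 < μe ∧ μe < -357 / 400 ∧ MarginZero μe ∧
    ∀ μ ∈ Set.Ioc μe (-69 / 80 : ℝ), ∀ χ : D4Irrep, IsRival χ →
      channelInf (squareDispersion 1 0) μ 1 D4Irrep.B1g < channelInf (squareDispersion 1 0) μ 1 χ

/-- **One certified negative record away**: a record accepted by `notB1gCheck χ` whose window ends at `mua = -67/50`, with its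
enclosures, together with the LANDED window record `klCertB1gWinU1` (`klCertB1gWinU1_check`; hypothesis `klCertB1gWinU1.EnclosuresB1g`,
the standing named numerical hypothesis of `klb1g_window_d005_d035`) proves the `t' = 0` edge datum. -/
theorem dWaveEdgeT0_of_records (cneg : KLCert) (χ : D4Irrep) (hc : notB1gCheck cneg χ = true) (hE : EnclosuresNotB1g cneg χ)
    (hmua : cneg.mua = -67 / 50) (hU1 : klCertB1gWinU1.EnclosuresB1g) : DWaveEdgeT0 := by
  have hmub : klCertB1gWinU1.mub = -357 / 400 := rfl
  have hmuaU1 : klCertB1gWinU1.mua = -69 / 80 := rfl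
  have hle : cneg.mua ≤ klCertB1gWinU1.mub := by rw [hmua, hmub]; norm_num
  obtain ⟨μe, hμe, hM, hsel⟩ := dWaveEdge_holds klCertB1gWinU1 cneg χ klCertB1gWinU1_check hU1 hc hE hle
  rw [hmua, hmub] at hμe
  rw [hmuaU1] at hsel
  refine ⟨μe, ?_, ?_, hM, ?_⟩
  · have h := hμe.1; push_cast at h; linarith
  · have h := hμe.2; push_cast at h; linarith
  · intro μ hμ χ' hχ'
    refine hsel μ ⟨hμ.1, ?_⟩ χ' hχ'
    have h := hμ.2; push_cast; linarith

end KlNotB1g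

end Summit.HubbardSuperconductivity.HubbardSuperconductivity.Theorems
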